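import Summits.ResolutionOfSingularities.ResolutionOfSingularities.Theorems.FrobeniusLadderFInjectiveMacaulayficationSequentialSurgeryGlue
import Summits.ResolutionOfSingularities.ResolutionOfSingularities.Theorems.FrobeniusLadderFInjectiveMacaulayficationPointFixableCentre
import HarnessLib

/-!
# Curve stage, §C0 — the closed-locus step (#3β) at `η` from a BLOW-UP DATUM good over its centre
# (crux `FInjectiveMacaulayfication` stmt-ResolutionOfSingularities-15315, chain w45a, hole #3β; U13 `CurveStageProducer`, file 1/3)

[OURS · L1 W4.5a · res-D-pv-019 AS res-L1-w45a-stub-7] Support file (`--supports stmt-ResolutionOfSingularities-15315 --as helper`)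
for the crux `FrobeniusLadder.FInjectiveMacaulayfication`; NOT a statement of any manuscript; AI-written, weaker than expert review.
Statement = §C0 `stub_closedLocusStep_of_blowupDatum` of strat-1's `L/res-L1-w45a-strat-1/CurveStageSig.lean` (HOLE-#3β LOCAL-CURRENCY
SIG OF RECORD, plan-1 R12.38; on-disk sha16 935ed93c8e42a36f, announced as f81f934dfe54696f) VERBATIM with `stub_` dropped.

THE THEOREM (`closedLocusStep_of_blowupDatum`, instance-form glue target). `(X₁, f₁)` admissible (separated, locally of finite
type, quasi-compact, integral, every stalk Cohen–Macaulay, `char k = p`), `η ∈ X₁`, and a blowing up `π : X₂ ⟶ X₁` along an ideal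
sheaf `J ≠ ⊥` with `η ∈ supp J`, FULL (domain ∧ CM ∧ Frobenius-closed parameter ideals) at every NON-CLOSED point of `X₂` over
`supp J` and Cohen–Macaulay at every CLOSED point over `supp J` ⊢ the #3β conclusion at `η` with `Z := supp J`.
PROOF (tree facts only): `IsBlowup.isProper` (GW 13.96 (1)), `IsBlowup.isBirational'` / `IsBlowup.isIntegral` (blow-ups of integral
schemes along `J ≠ ⊥`, `BlowupsIntegral`), `IsBlowup.isIso_compl` (iso off the centre, Stacks 02OS), Cohen–Macaulayness off
`supp J` by stalk transport across the isomorphism locus (`IsoLocusTransport.cmClause_iff_of_isIso_morphismRestrict`) and over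
`supp J` by the case split closed / non-closed. No named facts.
-/

-- single-problem summit: the doubled namespace component is forced
set_option linter.dupNamespace false

noncomputable section

open AlgebraicGeometry CategoryTheory Literature.AlgebraicGeometry.Resolution TopologicalSpace IsLocalRing

namespace Summit.ResolutionOfSingularities.ResolutionOfSingularities.Theorems.FInjectiveMacaulayfication.CurveStageGlue

open Summit.ResolutionOfSingularities.ResolutionOfSingularities.Theorems.FInjectiveMacaulayfication

/-- **§C0 — the closed-locus step at `η` from a blow-up datum good over its centre** (`CurveStageSig` §C0
`stub_closedLocusStep_of_blowupDatum`, verbatim): proper / birational / integral / iso off `supp J` are tree facts about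
blow-ups of integral schemes along non-zero ideal sheaves; Cohen–Macaulayness of `X₂` is transported from `X₁` off `supp J` and
read from the two fibre hypotheses over `supp J`; `Z := supp J`. [folklore] -/
theorem closedLocusStep_of_blowupDatum : ∀ (p : ℕ), p.Prime → ∀ (k : Type) [Field k] [CharP k p]
    (X₁ : Scheme.{0}) (f₁ : X₁ ⟶ Spec (.of k)),
      IsSeparated f₁ → LocallyOfFiniteType f₁ → QuasiCompact f₁ → IsIntegral X₁ →
      (∀ x : X₁, ∀ d : ℕ, ringKrullDim (X₁.presheaf.stalk x) = d → ∀ s : Fin d → X₁.presheaf.stalk x,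
        (Ideal.span (Set.range s)).radical.IsMaximal → RingTheory.Sequence.IsWeaklyRegular (X₁.presheaf.stalk x) (List.ofFn s)) →
      ∀ (η : X₁) (J : X₁.IdealSheafData) (X₂ : Scheme.{0}) (π : X₂ ⟶ X₁), J ≠ ⊥ → η ∈ (J.support : Set X₁) → IsBlowup π J →
      (∀ x : X₂, π.base x ∈ (J.support : Set X₁) → ¬ IsClosed ({x} : Set X₂) →
        IsDomain (X₂.presheaf.stalk x) ∧ ∀ d : ℕ, ringKrullDim (X₂.presheaf.stalk x) = d → ∀ s : Fin d → X₂.presheaf.stalk x,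
          (Ideal.span (Set.range s)).radical.IsMaximal → RingTheory.Sequence.IsWeaklyRegular (X₂.presheaf.stalk x) (List.ofFn s) ∧
          ∀ t : X₂.presheaf.stalk x, (∃ e : ℕ, t ^ p ^ e ∈ Ideal.span ((fun z : X₂.presheaf.stalk x => z ^ p ^ e) ''
            (Ideal.span (Set.range s) : Set (X₂.presheaf.stalk x)))) → t ∈ Ideal.span (Set.range s)) →
      (∀ x : X₂, π.base x ∈ (J.support : Set X₁) → IsClosed ({x} : Set X₂) →
        ∀ d : ℕ, ringKrullDim (X₂.presheaf.stalk x) = d → ∀ s : Fin d → X₂.presheaf.stalk x,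
          (Ideal.span (Set.range s)).radical.IsMaximal → RingTheory.Sequence.IsWeaklyRegular (X₂.presheaf.stalk x) (List.ofFn s)) →
      IsProper π ∧ IsBirational π ∧ IsIntegral X₂ ∧
        (∀ x : X₂, ∀ d : ℕ, ringKrullDim (X₂.presheaf.stalk x) = d → ∀ s : Fin d → X₂.presheaf.stalk x,
          (Ideal.span (Set.range s)).radical.IsMaximal → RingTheory.Sequence.IsWeaklyRegular (X₂.presheaf.stalk x) (List.ofFn s)) ∧
        ∃ (Z : Set X₁) (hZ : IsClosed Z), η ∈ Z ∧ IsIso (π ∣_ ⟨Zᶜ, hZ.isOpen_compl⟩) ∧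
          ∀ x : X₂, π.base x ∈ Z → ¬ IsClosed ({x} : Set X₂) →
            (IsDomain (X₂.presheaf.stalk x) ∧ ∀ d : ℕ, ringKrullDim (X₂.presheaf.stalk x) = d → ∀ s : Fin d → X₂.presheaf.stalk x,
              (Ideal.span (Set.range s)).radical.IsMaximal → RingTheory.Sequence.IsWeaklyRegular (X₂.presheaf.stalk x) (List.ofFn s) ∧
              ∀ t : X₂.presheaf.stalk x, (∃ e : ℕ, t ^ p ^ e ∈ Ideal.span ((fun z : X₂.presheaf.stalk x => z ^ p ^ e) ''
                (Ideal.span (Set.range s) : Set (X₂.presheaf.stalk x)))) → t ∈ Ideal.span (Set.range s))  := by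
  intro p hp k _ _ X₁ f₁ hsep hft hqc hint hCM η J X₂ π hJ0 hη hπ hnc hcl
  haveI := hsep
  haveI := hft
  haveI := hqc
  haveI : IsLocallyNoetherian X₁ := LocallyOfFiniteType.isLocallyNoetherian f₁
  haveI : IsProper π := hπ.isProper
  haveI : IsIntegral X₂ := hπ.isIntegral hJ0
  haveI : IsIso (π ∣_ centreCompl J) := hπ.isIso_compl
  -- Cohen–Macaulayness of every stalk of `X₂`
  have hCM₂ : ∀ x : X₂, ∀ d : ℕ, ringKrullDim (X₂.presheaf.stalk x) = d → ∀ s : Fin d → X₂.presheaf.stalk x,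
      (Ideal.span (Set.range s)).radical.IsMaximal → RingTheory.Sequence.IsWeaklyRegular (X₂.presheaf.stalk x) (List.ofFn s) := by
    intro x
    by_cases hx : π.base x ∈ (J.support : Set X₁)
    · by_cases hxc : IsClosed ({x} : Set X₂)
      · exact hcl x hx hxc
      · exact fun d hd s hs => ((hnc x hx hxc).2 d hd s hs).1
    · exact (IsoLocusTransport.cmClause_iff_of_isIso_morphismRestrict π (centreCompl J) x hx).mp (hCM (π.base x))
  exact ⟨inferInstance, hπ.isBirational' hJ0, inferInstance, hCM₂, (J.support : Set X₁), J.support.isClosed, hη,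
    hπ.isIso_compl, hnc⟩

end Summit.ResolutionOfSingularities.ResolutionOfSingularities.Theorems.FInjectiveMacaulayfication.CurveStageGlue

end
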